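import Literature.AlgebraicGeometry.Frobenioids.Frobenioid
import Literature.AlgebraicGeometry.Frobenioids.UnitWiseFrobenius
import HarnessLib

/-!
# Frobenioids I: the notions of Definitions 1.1–1.2 under an isomorphism of structure functors

Mochizuki, *The geometry of Frobenioids I: the general theory*, Kyushu J. Math. **62** (2008)
293–400, §1, Definition 1.1 (iii)(iv), Definition 1.2 (i)–(v), kurims pp. 19–24
[cite: MochizukiFrdI2008, Def. 1.2 p.21].

A (pre-)Frobenioid is a functor `F : C → F_Φ`; the notions of Def. 1.2 (linear, isometry,
base-isomorphism, pre-step, co-angular, pull-back morphism, of Frobenius type, isotropic, …) are read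
off `Base(φ)`, `Div(φ)`, `deg_Fr(φ)` of `F(φ)`.  This file records how they behave under an
ISOMORPHISM OF STRUCTURE FUNCTORS `e : F ≅ F'` (a "1-commutative" identification of two structures on
the same category `C`, FrdI §0 p. 15): the component `e_A` is an isomorphism of `F_Φ`, hence
(Φ sharp) `Div(e_A) = 0`, `deg_Fr(e_A) = 1`, `Base(e_A) =: b_A` an isomorphism of `D`, and

  `Base_{F'}(φ) = b_A⁻¹ ∘ Base_F(φ) ∘ b_B`, `deg_{Fr,F'}(φ) = deg_{Fr,F}(φ)`, `Div_{F'}(φ) = (b_A⁻¹)^* Div_F(φ)`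

(diagrammatic composition in the Lean statements).  Consequently every notion of Def. 1.2 is the
same for `F` and `F'` (`…_iff` below), `O^▷`, `O^×` coincide, and a pre-Frobenioid structure
transports (`IsPreFrobenioid.of_natIso`).  The Frobenioid conditions (Def. 1.3) are transported in
`FrobenioidNatIsoTransport.lean`.  Tooling for GAP row G-L6t9-1 (sub-DAG W7, row P25-L09); no new
definitions; nothing here is specific to [IUTchIII].
-/

namespace Literature.AlgebraicGeometry.Frobenioids

open CategoryTheory Opposite

universe w v v' u u'

namespace PreFrobenioid

namespace StructureIso

variable {D : Type u} [Category.{v} D] {Φ : Dᵒᵖ ⥤ CommMonCat.{w}}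
  {C : Type u'} [Category.{v'} C] {F F' : C ⥤ ElemFrobenioid Φ}

/-! ### Definition 1.1 (iv) under an isomorphism of structures -/

/-- **A structure isomorphic to a pre-Frobenioid is a pre-Frobenioid**: the conditions of Def. 1.1
(iv) concern `Φ`, `D` and `C` only (the isomorphism is not even needed).
[cite: MochizukiFrdI2008, Def. 1.1(iv) p.19] -/
theorem _root_.Literature.AlgebraicGeometry.Frobenioids.IsPreFrobenioid.of_natIso (_e : F ≅ F')
    (hP : IsPreFrobenioid Φ F) : IsPreFrobenioid Φ F' where
  isMonoidOn := hP.isMonoidOn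
  isDivisorial := hP.isDivisorial
  isGraphConnected_base := hP.isGraphConnected_base
  isTotallyEpimorphic_base := hP.isTotallyEpimorphic_base
  isGraphConnected := hP.isGraphConnected
  isTotallyEpimorphic := hP.isTotallyEpimorphic

variable (e : F ≅ F')

include e

/-! ### The components of `e` -/

/-- `F'(φ) = e_A⁻¹ ∘ F(φ) ∘ e_B` (naturality). [cite: MochizukiFrdI2008, §0 p.15] -/
theorem map_eq {A B : C} (φ : A ⟶ B) : F'.map φ = e.inv.app A ≫ F.map φ ≫ e.hom.app B := by
  rw [← Category.assoc, ← e.inv.naturality φ, Category.assoc, Iso.inv_hom_id_app, Category.comp_id]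

/-- `deg_Fr(e_A) = 1`. [cite: MochizukiFrdI2008, Def. 1.1(iii) p.19] -/
theorem degFr_hom_app (A : C) : ElemFrobenioid.degFr (e.hom.app A) = 1 :=
  ElemFrobenioid.degFr_eq_one_of_isIso (e.app A).hom

/-- `deg_Fr(e_A⁻¹) = 1`. [cite: MochizukiFrdI2008, Def. 1.1(iii) p.19] -/
theorem degFr_inv_app (A : C) : ElemFrobenioid.degFr (e.inv.app A) = 1 :=
  ElemFrobenioid.degFr_eq_one_of_isIso (e.app A).inv

/-- `Div(e_A) = 0` when `Φ` is sharp. [cite: MochizukiFrdI2008, Def. 1.1(iii) p.19] -/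
theorem div_hom_app (hΦ : ∀ A : D, IsSharp (Φ.obj (op A))) (A : C) :
    ElemFrobenioid.Div (e.hom.app A) = 1 :=
  ElemFrobenioid.div_eq_one_of_isIso hΦ (e.app A).hom

/-- `Div(e_A⁻¹) = 0` when `Φ` is sharp. [cite: MochizukiFrdI2008, Def. 1.1(iii) p.19] -/
theorem div_inv_app (hΦ : ∀ A : D, IsSharp (Φ.obj (op A))) (A : C) :
    ElemFrobenioid.Div (e.inv.app A) = 1 :=
  ElemFrobenioid.div_eq_one_of_isIso hΦ (e.app A).inv

/-- `Base(e_A⁻¹) ∘ … ∘`: `b_A⁻¹ ≫ b_A = 𝟙`. [cite: MochizukiFrdI2008, §0 p.15] -/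
theorem base_inv_hom_app (A : C) :
    ElemFrobenioid.Base (e.inv.app A) ≫ ElemFrobenioid.Base (e.hom.app A) = 𝟙 _ := by
  rw [← ElemFrobenioid.base_comp, Iso.inv_hom_id_app]; rfl

/-- `b_A ≫ b_A⁻¹ = 𝟙`. [cite: MochizukiFrdI2008, §0 p.15] -/
theorem base_hom_inv_app (A : C) :
    ElemFrobenioid.Base (e.hom.app A) ≫ ElemFrobenioid.Base (e.inv.app A) = 𝟙 _ := by
  rw [← ElemFrobenioid.base_comp, Iso.hom_inv_id_app]; rfl

/-- `b_A` is an isomorphism of `D`. [cite: MochizukiFrdI2008, §0 p.15] -/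
theorem isIso_base_hom_app (A : C) : IsIso (ElemFrobenioid.Base (e.hom.app A)) :=
  ElemFrobenioid.isIso_base_of_isIso (e.app A).hom

/-- `b_A⁻¹` is an isomorphism of `D`. [cite: MochizukiFrdI2008, §0 p.15] -/
theorem isIso_base_inv_app (A : C) : IsIso (ElemFrobenioid.Base (e.inv.app A)) :=
  ElemFrobenioid.isIso_base_of_isIso (e.app A).inv

/-- Reassociated `b_A ≫ b_A⁻¹ = 𝟙`. [cite: MochizukiFrdI2008, §0 p.15] -/
theorem base_hom_inv_app_assoc {A : C} {Z : D} (f : baseObj F A ⟶ Z) :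
    ElemFrobenioid.Base (e.hom.app A) ≫ ElemFrobenioid.Base (e.inv.app A) ≫ f = f := by
  rw [← Category.assoc, base_hom_inv_app, Category.id_comp]

/-- Reassociated `b_A⁻¹ ≫ b_A = 𝟙`. [cite: MochizukiFrdI2008, §0 p.15] -/
theorem base_inv_hom_app_assoc {A : C} {Z : D} (f : baseObj F' A ⟶ Z) :
    ElemFrobenioid.Base (e.inv.app A) ≫ ElemFrobenioid.Base (e.hom.app A) ≫ f = f := by
  rw [← Category.assoc, base_inv_hom_app, Category.id_comp]

/-- `b_A^* ∘ (b_A⁻¹)^* = id` on `Φ(A_D)`. [cite: MochizukiFrdI2008, Def. 1.1(ii) p.19] -/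
theorem pull_hom_pull_inv {A : C} (x : Φ.obj (op (baseObj F A))) :
    pull Φ (ElemFrobenioid.Base (e.hom.app A)) (pull Φ (ElemFrobenioid.Base (e.inv.app A)) x) = x := by
  rw [← pull_comp, base_hom_inv_app, pull_id]

/-- `(b_A⁻¹)^* ∘ b_A^* = id` on `Φ(A'_D)`. [cite: MochizukiFrdI2008, Def. 1.1(ii) p.19] -/
theorem pull_inv_pull_hom {A : C} (x : Φ.obj (op (baseObj F' A))) :
    pull Φ (ElemFrobenioid.Base (e.inv.app A)) (pull Φ (ElemFrobenioid.Base (e.hom.app A)) x) = x := by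
  rw [← pull_comp, base_inv_hom_app, pull_id]

/-! ### `Base`, `deg_Fr`, `Div` under `e` -/

/-- **`Base_{F'}(φ) = b_A⁻¹ ≫ Base_F(φ) ≫ b_B`.** [cite: MochizukiFrdI2008, Def. 1.1(iv) p.19] -/
theorem base_eq {A B : C} (φ : A ⟶ B) :
    Base F' φ = ElemFrobenioid.Base (e.inv.app A) ≫ Base F φ ≫ ElemFrobenioid.Base (e.hom.app B) := by
  show ElemFrobenioid.Base (F'.map φ) = _
  rw [map_eq e φ, ElemFrobenioid.base_comp, ElemFrobenioid.base_comp]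

/-- **`deg_{Fr,F'}(φ) = deg_{Fr,F}(φ)`.** [cite: MochizukiFrdI2008, Def. 1.1(iv) p.19] -/
theorem degFr_eq {A B : C} (φ : A ⟶ B) : degFr F' φ = degFr F φ := by
  show ElemFrobenioid.degFr (F'.map φ) = _
  rw [map_eq e φ, ElemFrobenioid.degFr_comp, ElemFrobenioid.degFr_comp, degFr_inv_app, degFr_hom_app,
    one_mul, mul_one]

/-- **`Div_{F'}(φ) = (b_A⁻¹)^* Div_F(φ)`** (for `Φ` sharp). [cite: MochizukiFrdI2008, Def. 1.1(iv) p.19] -/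
theorem div_eq (hΦ : ∀ A : D, IsSharp (Φ.obj (op A))) {A B : C} (φ : A ⟶ B) :
    Div F' φ = pull Φ (ElemFrobenioid.Base (e.inv.app A)) (Div F φ) := by
  show ElemFrobenioid.Div (F'.map φ) = _
  rw [map_eq e φ, ElemFrobenioid.div_comp, ElemFrobenioid.div_comp, div_inv_app e hΦ, one_pow, mul_one,
    div_hom_app e hΦ, map_one, one_mul, degFr_hom_app, PNat.one_coe, pow_one]

/-- `Div_F(φ) = b_A^* Div_{F'}(φ)` (the inverse reading). [cite: MochizukiFrdI2008, Def. 1.1(iv) p.19] -/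
theorem pull_div_eq (hΦ : ∀ A : D, IsSharp (Φ.obj (op A))) {A B : C} (φ : A ⟶ B) :
    pull Φ (ElemFrobenioid.Base (e.hom.app A)) (Div F' φ) = Div F φ := by
  rw [div_eq e hΦ, ← pull_comp, base_hom_inv_app, pull_id]

/-! ### Definition 1.2 under `e` -/

/-- Linear for `F'` iff for `F`. [cite: MochizukiFrdI2008, Def. 1.2(i) p.21] -/
theorem isLinear_iff {A B : C} (φ : A ⟶ B) : IsLinear F' φ ↔ IsLinear F φ := by
  unfold IsLinear; rw [degFr_eq e]

/-- Isometry for `F'` iff for `F`. [cite: MochizukiFrdI2008, Def. 1.2(i) p.21] -/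
theorem isIsometry_iff (hΦ : ∀ A : D, IsSharp (Φ.obj (op A))) {A B : C} (φ : A ⟶ B) :
    IsIsometry F' φ ↔ IsIsometry F φ := by
  haveI := isIso_base_inv_app e A
  unfold IsIsometry
  rw [div_eq e hΦ, ← map_one (pull Φ (ElemFrobenioid.Base (e.inv.app A)))]
  exact (pull_injective_of_isIso Φ _).eq_iff

/-- Metric equivalence for `F'` iff for `F`. [cite: MochizukiFrdI2008, Def. 1.2(i) p.21] -/
theorem metricallyEquivalent_iff (hΦ : ∀ A : D, IsSharp (Φ.obj (op A))) {A B : C} (φ ψ : A ⟶ B) :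
    MetricallyEquivalent F' φ ψ ↔ MetricallyEquivalent F φ ψ := by
  haveI := isIso_base_inv_app e A
  unfold MetricallyEquivalent
  rw [div_eq e hΦ, div_eq e hΦ]
  exact (pull_injective_of_isIso Φ _).eq_iff

/-- `Div_{F'}(φ) ∣ Div_{F'}(ψ)` iff `Div_F(φ) ∣ Div_F(ψ)`. [cite: MochizukiFrdI2008, Def. 1.3(iii) p.25] -/
theorem div_dvd_iff (hΦ : ∀ A : D, IsSharp (Φ.obj (op A))) {A B B' : C} (φ : A ⟶ B) (ψ : A ⟶ B') :
    Div F' φ ∣ Div F' ψ ↔ Div F φ ∣ Div F ψ := by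
  rw [div_eq e hΦ, div_eq e hΦ]
  refine ⟨fun h => ?_, fun h => map_dvd _ h⟩
  have h' := map_dvd (pull Φ (ElemFrobenioid.Base (e.hom.app A))) h
  rwa [pull_hom_pull_inv e, pull_hom_pull_inv e] at h'

/-- Base-isomorphism for `F'` iff for `F`. [cite: MochizukiFrdI2008, Def. 1.2(ii) p.21] -/
theorem isBaseIso_iff {A B : C} (φ : A ⟶ B) : IsBaseIso F' φ ↔ IsBaseIso F φ := by
  haveI := isIso_base_inv_app e A
  haveI := isIso_base_hom_app e B
  unfold IsBaseIso
  rw [base_eq e]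
  constructor
  · intro h
    haveI : IsIso ((ElemFrobenioid.Base (e.inv.app A) ≫ Base F φ) ≫ ElemFrobenioid.Base (e.hom.app B)) := by
      rw [Category.assoc]; exact h
    haveI := IsIso.of_isIso_comp_right (ElemFrobenioid.Base (e.inv.app A) ≫ Base F φ)
      (ElemFrobenioid.Base (e.hom.app B))
    exact IsIso.of_isIso_comp_left (ElemFrobenioid.Base (e.inv.app A)) (Base F φ)
  · intro h
    haveI : IsIso (Base F φ) := h
    infer_instance

/-- Base-equivalence for `F'` iff for `F`. [cite: MochizukiFrdI2008, Def. 1.2(ii) p.22] -/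
theorem baseEquivalent_iff {A B : C} (φ ψ : A ⟶ B) : BaseEquivalent F' φ ψ ↔ BaseEquivalent F φ ψ := by
  haveI := isIso_base_inv_app e A
  haveI := isIso_base_hom_app e B
  unfold BaseEquivalent
  rw [base_eq e, base_eq e]
  constructor
  · intro h
    exact (cancel_mono _).mp ((cancel_epi _).mp h)
  · intro h; rw [h]

/-- `Base_{F'}(φ) = Base_{F'}(ψ)` iff `Base_F(φ) = Base_F(ψ)`. [cite: MochizukiFrdI2008, Def. 1.2(ii) p.22] -/
theorem base_eq_base_iff {A B : C} (φ ψ : A ⟶ B) : Base F' φ = Base F' ψ ↔ Base F φ = Base F ψ :=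
  baseEquivalent_iff e φ ψ

/-- Base-identity for `F'` iff for `F`. [cite: MochizukiFrdI2008, Def. 1.2(ii) p.22] -/
theorem isBaseIdentity_iff {A : C} (φ : A ⟶ A) : IsBaseIdentity F' φ ↔ IsBaseIdentity F φ := by
  have h := base_eq_base_iff e φ (𝟙 A)
  rwa [base_id, base_id] at h

/-- Pre-step for `F'` iff for `F`. [cite: MochizukiFrdI2008, Def. 1.2(iii) p.22] -/
theorem isPreStep_iff {A B : C} (φ : A ⟶ B) : IsPreStep F' φ ↔ IsPreStep F φ :=
  and_congr (isLinear_iff e φ) (isBaseIso_iff e φ)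

/-- Co-angular for `F'` iff for `F`. [cite: MochizukiFrdI2008, Def. 1.2(iii) p.22] -/
theorem isCoAngular_iff (hΦ : ∀ A : D, IsSharp (Φ.obj (op A))) {A B : C} (φ : A ⟶ B) :
    IsCoAngular F' φ ↔ IsCoAngular F φ := by
  unfold IsCoAngular
  simp only [isLinear_iff e, isIsometry_iff e hΦ, isPreStep_iff e, isBaseIso_iff e]

/-- LB-invertible for `F'` iff for `F`. [cite: MochizukiFrdI2008, Def. 1.2(iii) p.22] -/
theorem isLBInvertible_iff (hΦ : ∀ A : D, IsSharp (Φ.obj (op A))) {A B : C} (φ : A ⟶ B) :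
    IsLBInvertible F' φ ↔ IsLBInvertible F φ :=
  and_congr (isCoAngular_iff e hΦ φ) (isIsometry_iff e hΦ φ)

/-- Of Frobenius type for `F'` iff for `F`. [cite: MochizukiFrdI2008, Def. 1.2(iii) p.22] -/
theorem isFrobeniusType_iff (hΦ : ∀ A : D, IsSharp (Φ.obj (op A))) {A B : C} (φ : A ⟶ B) :
    IsFrobeniusType F' φ ↔ IsFrobeniusType F φ :=
  and_congr (isLBInvertible_iff e hΦ φ) (isBaseIso_iff e φ)

/-- Co-angular pre-step for `F'` iff for `F`. [cite: MochizukiFrdI2008, Def. 1.3(iii) p.25] -/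
theorem isCoAngularPreStep_iff (hΦ : ∀ A : D, IsSharp (Φ.obj (op A))) {A B : C} (φ : A ⟶ B) :
    IsCoAngularPreStep F' φ ↔ IsCoAngularPreStep F φ :=
  and_congr (isCoAngular_iff e hΦ φ) (isPreStep_iff e φ)

/-- Transfer of a pull-back datum from `F` to `F'`: if `Base_F(g) = t ∘ Base_F(φ)` then
`Base_{F'}(g) = (b_X⁻¹ t b_A) ∘ Base_{F'}(φ)`. [cite: MochizukiFrdI2008, Def. 1.2(ii) p.21] -/
theorem base_eq_comp_of_base_eq_comp {A B X : C} (φ : A ⟶ B) (g : X ⟶ B)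
    (t : baseObj F X ⟶ baseObj F A) (h : Base F g = t ≫ Base F φ) :
    Base F' g = (ElemFrobenioid.Base (e.inv.app X) ≫ t ≫ ElemFrobenioid.Base (e.hom.app A)) ≫ Base F' φ := by
  rw [base_eq e, h, base_eq e]
  simp only [Category.assoc, base_hom_inv_app_assoc e]

/-- Transfer of a pull-back datum from `F'` to `F`. [cite: MochizukiFrdI2008, Def. 1.2(ii) p.21] -/
theorem base_eq_comp_of_base_eq_comp' {A B X : C} (φ : A ⟶ B) (g : X ⟶ B)
    (s : baseObj F' X ⟶ baseObj F' A) (h : Base F' g = s ≫ Base F' φ) :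
    Base F g = (ElemFrobenioid.Base (e.hom.app X) ≫ s ≫ ElemFrobenioid.Base (e.inv.app A)) ≫ Base F φ := by
  rw [base_eq e, base_eq e] at h
  have h' := congrArg
    (fun r => ElemFrobenioid.Base (e.hom.app X) ≫ r ≫ ElemFrobenioid.Base (e.inv.app B)) h
  simpa only [Category.assoc, base_hom_inv_app_assoc e, base_hom_inv_app e, Category.comp_id] using h'

/-- Pull-back morphism for `F'` iff for `F`: the pull-back data `(g, t)` for `F` and `F'` correspond
under `t ↦ b_X⁻¹ ∘ t ∘ b_A`, compatibly with the maps `γ ↦ (φ ∘ γ, Base γ)`.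
[cite: MochizukiFrdI2008, Def. 1.2(ii) p.21] -/
theorem isPullbackMorphism_iff {A B : C} (φ : A ⟶ B) : IsPullbackMorphism F' φ ↔ IsPullbackMorphism F φ := by
  refine forall_congr' fun X => ?_
  let T : PullbackHomData F φ X ≃ PullbackHomData F' φ X :=
    { toFun := fun p => ⟨(p.1.1, ElemFrobenioid.Base (e.inv.app X) ≫ p.1.2 ≫
          ElemFrobenioid.Base (e.hom.app A)), base_eq_comp_of_base_eq_comp e φ p.1.1 p.1.2 p.2⟩
      invFun := fun q => ⟨(q.1.1, ElemFrobenioid.Base (e.hom.app X) ≫ q.1.2 ≫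
          ElemFrobenioid.Base (e.inv.app A)), base_eq_comp_of_base_eq_comp' e φ q.1.1 q.1.2 q.2⟩
      left_inv := fun p => by
        apply Subtype.ext
        dsimp only
        refine Prod.ext rfl ?_
        show ElemFrobenioid.Base (e.hom.app X) ≫ (ElemFrobenioid.Base (e.inv.app X) ≫ p.1.2 ≫
          ElemFrobenioid.Base (e.hom.app A)) ≫ ElemFrobenioid.Base (e.inv.app A) = p.1.2
        simp only [Category.assoc, base_hom_inv_app_assoc e, base_hom_inv_app e, Category.comp_id]
      right_inv := fun q => by
        apply Subtype.ext
        dsimp only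
        refine Prod.ext rfl ?_
        show ElemFrobenioid.Base (e.inv.app X) ≫ (ElemFrobenioid.Base (e.hom.app X) ≫ q.1.2 ≫
          ElemFrobenioid.Base (e.inv.app A)) ≫ ElemFrobenioid.Base (e.hom.app A) = q.1.2
        simp only [Category.assoc, base_inv_hom_app_assoc e, base_inv_hom_app e, Category.comp_id] }
  have hT : pullbackHomMap F' φ X = T ∘ pullbackHomMap F φ X :=
    funext fun γ => Subtype.ext (Prod.ext rfl (base_eq e γ))
  rw [hT]
  exact Equiv.comp_bijective _ T

/-- Isotropic for `F'` iff for `F`. [cite: MochizukiFrdI2008, Def. 1.2(iv) p.23] -/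
theorem isIsotropic_iff (hΦ : ∀ A : D, IsSharp (Φ.obj (op A))) (A : C) : IsIsotropic F' A ↔ IsIsotropic F A := by
  unfold IsIsotropic
  simp only [isIsometry_iff e hΦ, isPreStep_iff e]

/-- Isotropic hull for `F'` iff for `F`. [cite: MochizukiFrdI2008, Def. 1.2(iv) p.23] -/
theorem isIsotropicHull_iff (hΦ : ∀ A : D, IsSharp (Φ.obj (op A))) {A B : C} (φ : A ⟶ B) :
    IsIsotropicHull F' φ ↔ IsIsotropicHull F φ := by
  unfold IsIsotropicHull
  simp only [isIsometry_iff e hΦ, isPreStep_iff e, isIsotropic_iff e hΦ]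

/-- `O^▷(A)` is the same submonoid of `End(A)` for `F'` and `F`. [cite: MochizukiFrdI2008, Def. 1.2(ii) p.22] -/
theorem endSubmonoid_eq (A : C) : endSubmonoid F' A = endSubmonoid F A := by
  ext φ
  exact and_congr (isBaseIdentity_iff e φ) (isLinear_iff e φ)

/-- `O^×(A)` is the same subgroup of `Aut(A)` for `F'` and `F`. [cite: MochizukiFrdI2008, Def. 1.2(ii) p.22] -/
theorem unitsSubgroup_eq (A : C) : unitsSubgroup F' A = unitsSubgroup F A := by
  ext α
  exact and_congr (isBaseIdentity_iff e α.hom) (isLinear_iff e α.hom)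

/-- Frobenius-trivial for `F'` iff for `F`. [cite: MochizukiFrdI2008, Def. 1.2(iv) p.23] -/
theorem isFrobeniusTrivial_iff (hΦ : ∀ A : D, IsSharp (Φ.obj (op A))) (A : C) :
    IsFrobeniusTrivial F' A ↔ IsFrobeniusTrivial F A := by
  constructor
  · rintro ⟨ζ, hζ⟩
    refine ⟨ζ, fun n => ⟨?_, ?_, ?_⟩⟩
    · exact (degFr_eq e (show A ⟶ A from ζ n)).symm.trans (hζ n).1
    · exact (isBaseIdentity_iff e (show A ⟶ A from ζ n)).mp (hζ n).2.1
    · exact (isFrobeniusType_iff e hΦ (show A ⟶ A from ζ n)).mp (hζ n).2.2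
  · rintro ⟨ζ, hζ⟩
    refine ⟨ζ, fun n => ⟨?_, ?_, ?_⟩⟩
    · exact (degFr_eq e (show A ⟶ A from ζ n)).trans (hζ n).1
    · exact (isBaseIdentity_iff e (show A ⟶ A from ζ n)).mpr (hζ n).2.1
    · exact (isFrobeniusType_iff e hΦ (show A ⟶ A from ζ n)).mpr (hζ n).2.2

/-- Base-isomorphic objects for `F'` iff for `F`. [cite: MochizukiFrdI2008, Def. 1.2(ii) p.21] -/
theorem baseIsomorphic_iff (A B : C) : BaseIsomorphic F' A B ↔ BaseIsomorphic F A B := by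
  constructor
  · rintro ⟨i⟩
    exact ⟨(ElemFrobenioid.baseFunctor Φ).mapIso (e.app A) ≪≫ i ≪≫
      ((ElemFrobenioid.baseFunctor Φ).mapIso (e.app B)).symm⟩
  · rintro ⟨i⟩
    exact ⟨((ElemFrobenioid.baseFunctor Φ).mapIso (e.app A)).symm ≪≫ i ≪≫
      (ElemFrobenioid.baseFunctor Φ).mapIso (e.app B)⟩

/-- `(ψ^*)⁻¹ Div ψ` under `e`: `invDiv_{F'}(ψ) = (b_A⁻¹)^* invDiv_F(ψ)`.
[cite: MochizukiFrdI2008, Def. 1.3(iii) p.25] -/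
theorem invDiv_eq (hΦ : ∀ A : D, IsSharp (Φ.obj (op A))) {B A : C} (ψ : B ⟶ A) (h : IsBaseIso F ψ)
    (h' : IsBaseIso F' ψ) :
    invDiv F' ψ h' = pull Φ (ElemFrobenioid.Base (e.inv.app A)) (invDiv F ψ h) := by
  haveI : IsIso (Base F' ψ) := h'
  haveI : IsIso (Base F ψ) := h
  haveI := isIso_base_inv_app e A
  apply pull_injective_of_isIso Φ (Base F' ψ)
  rw [pull_invDiv ψ h', div_eq e hΦ, ← pull_comp, base_eq e, Category.assoc, Category.assoc,
    base_hom_inv_app, Category.comp_id, pull_comp, pull_invDiv ψ h]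

/-- `invDiv_{F'}(ψ') ∣ invDiv_{F'}(ψ)` iff the same for `F`. [cite: MochizukiFrdI2008, Def. 1.3(iii) p.25] -/
theorem invDiv_dvd_iff (hΦ : ∀ A : D, IsSharp (Φ.obj (op A))) {B B' A : C} (ψ : B ⟶ A) (ψ' : B' ⟶ A)
    (h : IsBaseIso F ψ) (h' : IsBaseIso F' ψ) (k : IsBaseIso F ψ') (k' : IsBaseIso F' ψ') :
    invDiv F' ψ' k' ∣ invDiv F' ψ h' ↔ invDiv F ψ' k ∣ invDiv F ψ h := by
  rw [invDiv_eq e hΦ ψ h h', invDiv_eq e hΦ ψ' k k']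
  refine ⟨fun hd => ?_, fun hd => map_dvd _ hd⟩
  have hd' := map_dvd (pull Φ (ElemFrobenioid.Base (e.hom.app A))) hd
  rwa [pull_hom_pull_inv e, pull_hom_pull_inv e] at hd'

end StructureIso

end PreFrobenioid

end Literature.AlgebraicGeometry.Frobenioids
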